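import Mathlib.Combinatorics.SimpleGraph.Paths
import HarnessLib

/-!
# Menger's theorem for two paths between vertex sets

Generic combinatorics of walks in a simple graph (topic `Literature/Combinatorics/SimpleGraph`),
written for the pivotal estimates of the two-open-arm event in Kesten's near-critical theory
(`Literature/Probability/Percolation`, the four-arm pivotal estimate behind Werner's Lemma 6.3:
P. Nolin, *Near-critical percolation in two dimensions*, Electron. J. Probab. 13 (2008), §6.2,
proof of Thm. 27, Case 3: "This new definition allows to use Menger's theorem (see [Diestel],
Theorem 3.3.1)": a site pivotal for the existence of two disjoint open arms lies, together with
ONE further open site, on a cut of all open arms).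

**The theorem** (Menger 1927; Diestel, *Graph Theory*, Thm. 3.3.1, the case `k = 2`, sets
version). Let `G` be a simple graph, `A` a set of admissible vertices and `S`, `T` vertex sets.
Call an `S`–`T` walk *admissible* if all its vertices lie in `A`. If there is an admissible
`S`–`T` walk, and for every admissible vertex `z` there is an admissible `S`–`T` walk avoiding
`z` (no one-vertex cut), then there are two admissible `S`–`T` paths with disjoint vertex sets
(`exists_two_disjoint_paths`); contrapositively, if there is an admissible `S`–`T` walk but no
two vertex-disjoint admissible `S`–`T` paths, some admissible vertex lies on every admissible
`S`–`T` walk (`exists_mem_support_forall`). No finiteness is assumed.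

**Proof** (an augmenting-path argument, self-contained). Maintain two admissible `S`–`T` paths
`p = a ++ b` and `r` meeting for the first time (along `p`) at the junction `x` of `a` and `b`
(`x ∈ r`, `a ∩ r ⊆ {x}`), and induct on the length of the tail `b`. Let `P⁻ = a ∖ {x}`,
`R⁻` = the vertices of `r` strictly before `x`, and let `q` be an admissible `S`–`T` path avoiding
`x`. If `q` avoids `L = P⁻ ∪ R⁻`, replace `r` by `q`. Otherwise let `y` be the last vertex of `q`
in `L` and `q₂` the final segment of `q` from `y` (so `q₂ ∩ L = {y}`, `x ∉ q₂`):
* if `y ∈ R⁻`, replace `r` by `r[→ y] ++ q₂`, a path avoiding `P⁻ ∪ {x}`;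
* if `y ∈ P⁻`, replace the pair by `p' = r[→ c] ++ b[c →]`, where `c` is the first vertex of
  `r` on `b`, and `r' = a[→ y] ++ q₂`; here `r' ∩ r[→ c] ⊆ {c}`.
In each case the new pair of admissible `S`–`T` paths either is disjoint or meets for the first
time strictly inside the old tail `b` (beyond `x`), so the tail shortens.

## Contents

* `exists_append_first_mem`, `exists_append_last_mem` — splitting a walk at its first / last
  vertex in a set;
* `isPath_append_iff'` — `p ++ q` is a path iff `p`, `q` are paths meeting only at the junction;
* `exists_two_disjoint_paths_step`, `exists_two_disjoint_paths_aux`, `exists_two_disjoint_paths` —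
  Menger's theorem, `k = 2`, sets version (one round, the induction, the theorem);
* `exists_mem_support_forall` — its contrapositive (a one-vertex cut).

Mathlib has walks, paths, `takeUntil`/`dropUntil`, `bypass`, but no form of Menger's theorem
(searched `Menger`, `disjoint` with `path`, `separator`, `vertex cut`).

## References

* K. Menger, Zur allgemeinen Kurventheorie, *Fund. Math.* 10 (1927) 96–115.
* R. Diestel, *Graph Theory*, 5th ed., GTM 173, Springer (2017), Thm. 3.3.1 [Diestel2017].
* P. Nolin, Near-critical percolation in two dimensions, *Electron. J. Probab.* 13 (2008), §6.2,
  proof of Thm. 27, Case 3 [arXiv 0711.4948: Thm. 26] [Nolin2008].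
-/

namespace Literature.Combinatorics.SimpleGraph

open _root_.SimpleGraph

variable {V : Type*} {G : _root_.SimpleGraph V}

/-! ### Splitting a walk at its first or last vertex in a set -/

/-- **First hit.** A walk meeting a set `L` splits as `p₁ ++ p₂` at a vertex `z ∈ L` such that
`z` is the only vertex of `p₁` in `L`. [folklore] -/
theorem exists_append_first_mem (L : Set V) :
    ∀ {u v : V} (p : G.Walk u v), (∃ y ∈ p.support, y ∈ L) →
      ∃ (z : V) (p₁ : G.Walk u z) (p₂ : G.Walk z v), p = p₁.append p₂ ∧ z ∈ L ∧
        ∀ y ∈ p₁.support, y ∈ L → y = z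
  | u, _, Walk.nil, h => by
    obtain ⟨y, hy, hyL⟩ := h
    rw [Walk.support_nil, List.mem_singleton] at hy
    subst hy
    exact ⟨_, Walk.nil, Walk.nil, rfl, hyL, fun w hw _ => by simpa using hw⟩
  | u, v, Walk.cons hadj p, h => by
    by_cases hu : u ∈ L
    · exact ⟨u, Walk.nil, Walk.cons hadj p, rfl, hu, fun w hw _ => by simpa using hw⟩
    · obtain ⟨y, hy, hyL⟩ := h
      rw [Walk.support_cons, List.mem_cons] at hy
      have hy' : y ∈ p.support := by
        rcases hy with rfl | hy
        · exact absurd hyL hu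
        · exact hy
      obtain ⟨z, p₁, p₂, hp, hz, hfirst⟩ := exists_append_first_mem L p ⟨y, hy', hyL⟩
      refine ⟨z, Walk.cons hadj p₁, p₂, by rw [hp]; rfl, hz, fun w hw hwL => ?_⟩
      rw [Walk.support_cons, List.mem_cons] at hw
      rcases hw with rfl | hw
      · exact absurd hwL hu
      · exact hfirst w hw hwL

/-- **Last hit.** A walk meeting a set `L` splits as `p₁ ++ p₂` at a vertex `z ∈ L` such that
`z` is the only vertex of `p₂` in `L`. [folklore] -/
theorem exists_append_last_mem (L : Set V) {u v : V} (p : G.Walk u v)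
    (h : ∃ y ∈ p.support, y ∈ L) :
    ∃ (z : V) (p₁ : G.Walk u z) (p₂ : G.Walk z v), p = p₁.append p₂ ∧ z ∈ L ∧
      ∀ y ∈ p₂.support, y ∈ L → y = z := by
  obtain ⟨z, q₁, q₂, hq, hz, hfirst⟩ := exists_append_first_mem L p.reverse (by
    obtain ⟨y, hy, hyL⟩ := h
    exact ⟨y, by rw [Walk.support_reverse, List.mem_reverse]; exact hy, hyL⟩)
  refine ⟨z, q₂.reverse, q₁.reverse, ?_, hz, fun y hy hyL => hfirst y ?_ hyL⟩
  · have h1 := congrArg Walk.reverse hq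
    rw [Walk.reverse_reverse, Walk.reverse_append] at h1
    exact h1
  · rw [Walk.support_reverse, List.mem_reverse] at hy
    exact hy

/-- **Concatenation of paths.** `p ++ q` is a path iff `p` and `q` are paths whose only common
vertex is the junction. [folklore] -/
theorem isPath_append_iff' {u v w : V} {p : G.Walk u v} {q : G.Walk v w} :
    (p.append q).IsPath ↔ p.IsPath ∧ q.IsPath ∧ ∀ y ∈ p.support, y ∈ q.support → y = v := by
  rw [Walk.isPath_def, Walk.isPath_def, Walk.isPath_def, Walk.support_append, List.nodup_append']
  have hq : q.support = v :: q.support.tail := (q.cons_tail_support).symm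
  constructor
  · rintro ⟨h1, h2, h3⟩
    refine ⟨h1, ?_, fun y hy hyq => ?_⟩
    · rw [hq, List.nodup_cons]
      exact ⟨fun hv => h3 p.end_mem_support hv, h2⟩
    · rw [hq, List.mem_cons] at hyq
      rcases hyq with h | h
      · exact h
      · exact absurd h (h3 hy)
  · rintro ⟨h1, h2, h3⟩
    rw [hq, List.nodup_cons] at h2
    refine ⟨h1, h2.2, fun y hy hyt => ?_⟩
    have hyv : y = v := h3 y hy (by rw [hq]; exact List.mem_cons_of_mem _ hyt)
    exact h2.1 (hyv ▸ hyt)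

/-! ### Menger's theorem for two paths -/

section Menger

variable {A S T : Set V}

/-- **One round of the construction behind Menger's theorem for two paths** (see the module
docstring): two admissible `S`–`T` paths `a ++ b` and `r` meeting for the first time at the
junction `x` of `a` and `b` either yield two vertex-disjoint admissible `S`–`T` paths, or a new
such configuration with a strictly shorter tail (handed to `rec`), provided every admissible
vertex is avoided by some admissible `S`–`T` walk. [cite: Diestel2017, Thm. 3.3.1] -/
theorem exists_two_disjoint_paths_step
    (hcut : ∀ z ∈ A, ∃ (s t : V) (q : G.Walk s t), s ∈ S ∧ t ∈ T ∧
      (∀ y ∈ q.support, y ∈ A) ∧ z ∉ q.support)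
    (s x t : V) (a : G.Walk s x) (b : G.Walk x t) (sr tr : V) (r : G.Walk sr tr)
    (hs : s ∈ S) (ht : t ∈ T) (hpath : (a.append b).IsPath)
    (hA : ∀ y ∈ (a.append b).support, y ∈ A) (hsr : sr ∈ S) (_htr : tr ∈ T) (hr : r.IsPath)
    (hrA : ∀ y ∈ r.support, y ∈ A) (hxr : x ∈ r.support)
    (hfirst : ∀ y ∈ a.support, y ∈ r.support → y = x)
    (rec : ∀ (s' x' t' : V) (a' : G.Walk s' x') (b' : G.Walk x' t') (sr' tr' : V)
      (r' : G.Walk sr' tr'), s' ∈ S → t' ∈ T → (a'.append b').IsPath →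
      (∀ y ∈ (a'.append b').support, y ∈ A) → sr' ∈ S → tr' ∈ T → r'.IsPath →
      (∀ y ∈ r'.support, y ∈ A) → x' ∈ r'.support →
      (∀ y ∈ a'.support, y ∈ r'.support → y = x') → b'.length < b.length →
      ∃ (s₁ t₁ s₂ t₂ : V) (p₁ : G.Walk s₁ t₁) (p₂ : G.Walk s₂ t₂),
        s₁ ∈ S ∧ t₁ ∈ T ∧ s₂ ∈ S ∧ t₂ ∈ T ∧ p₁.IsPath ∧ p₂.IsPath ∧
        (∀ y ∈ p₁.support, y ∈ A) ∧ (∀ y ∈ p₂.support, y ∈ A) ∧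
        ∀ y ∈ p₁.support, y ∉ p₂.support) :
    ∃ (s₁ t₁ s₂ t₂ : V) (p₁ : G.Walk s₁ t₁) (p₂ : G.Walk s₂ t₂),
        s₁ ∈ S ∧ t₁ ∈ T ∧ s₂ ∈ S ∧ t₂ ∈ T ∧ p₁.IsPath ∧ p₂.IsPath ∧
        (∀ y ∈ p₁.support, y ∈ A) ∧ (∀ y ∈ p₂.support, y ∈ A) ∧
        ∀ y ∈ p₁.support, y ∉ p₂.support := by
  classical
  obtain ⟨ha, hb, -⟩ := isPath_append_iff'.1 hpath
  have hxA : x ∈ A := hA x (by rw [Walk.mem_support_append_iff]; exact Or.inl a.end_mem_support)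
  -- `P⁻ = a ∖ {x}` misses `r`
  have haR : ∀ y ∈ a.support, y ≠ x → y ∉ r.support := fun y hy hyx hyR => hyx (hfirst y hy hyR)
  -- split `r` at `x`: `r = r₁ ++ r₂`
  obtain ⟨r₁, r₂, hr12⟩ := Walk.mem_support_iff_exists_append.1 hxr
  have hrpath : (r₁.append r₂).IsPath := by rw [← hr12]; exact hr
  obtain ⟨hr₁, -, -⟩ := isPath_append_iff'.1 hrpath
  have hr₁r : ∀ y ∈ r₁.support, y ∈ r.support := fun y hy => by
    rw [hr12, Walk.mem_support_append_iff]; exact Or.inl hy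
  have hr₁A : ∀ y ∈ r₁.support, y ∈ A := fun y hy => hrA y (hr₁r y hy)
  -- `R⁻ = r₁ ∖ {x}` misses `a`
  have hr₁a : ∀ y ∈ r₁.support, y ≠ x → y ∉ a.support := fun y hy hyx hya =>
    haR y hya hyx (hr₁r y hy)
  -- the set `L = P⁻ ∪ R⁻`
  obtain ⟨L, hL⟩ : ∃ L : Set V, L = {y | (y ∈ a.support ∨ y ∈ r₁.support) ∧ y ≠ x} := ⟨_, rfl⟩
  -- an admissible PATH `q` avoiding `x`
  obtain ⟨sq, tq, q₀, hsq, htq, hq₀A, hxq₀⟩ := hcut x hxA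
  set q : G.Walk sq tq := q₀.bypass with hqdef
  have hq : q.IsPath := q₀.bypass_isPath
  have hqq₀ : ∀ y ∈ q.support, y ∈ q₀.support := fun y hy => q₀.support_bypass_subset_support hy
  have hqA : ∀ y ∈ q.support, y ∈ A := fun y hy => hq₀A y (hqq₀ y hy)
  have hxq : x ∉ q.support := fun h => hxq₀ (hqq₀ x h)
  -- TERMINAL / RECURSIVE pattern: a new second path `r'` missing `a` entirely
  have finish : ∀ (sr' tr' : V) (r' : G.Walk sr' tr'), sr' ∈ S → tr' ∈ T → r'.IsPath →
      (∀ y ∈ r'.support, y ∈ A) → (∀ y ∈ a.support, y ∉ r'.support) →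
      ∃ (s₁ t₁ s₂ t₂ : V) (p₁ : G.Walk s₁ t₁) (p₂ : G.Walk s₂ t₂),
        s₁ ∈ S ∧ t₁ ∈ T ∧ s₂ ∈ S ∧ t₂ ∈ T ∧ p₁.IsPath ∧ p₂.IsPath ∧
        (∀ y ∈ p₁.support, y ∈ A) ∧ (∀ y ∈ p₂.support, y ∈ A) ∧
        ∀ y ∈ p₁.support, y ∉ p₂.support := by
    intro sr' tr' r' hsr' htr' hr' hr'A haR'
    by_cases hmeet : ∃ y ∈ b.support, y ∈ {y | y ∈ r'.support}
    · -- first vertex `z` of `b` on `r'`; recurse with `a ++ b[→ z]`, `b[z →]`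
      obtain ⟨z, b₁, b₂, hb12, hz, hzfirst⟩ :=
        exists_append_first_mem {y | y ∈ r'.support} b hmeet
      have hz' : z ∈ r'.support := hz
      have hzx : z ≠ x := fun h => haR' x a.end_mem_support (h ▸ hz')
      have hpath' : ((a.append b₁).append b₂).IsPath := by
        rw [← Walk.append_assoc, ← hb12]; exact hpath
      have hlen : b₂.length < b.length := by
        have h1 : b.length = b₁.length + b₂.length := by rw [hb12, Walk.length_append]
        have : b₁.length ≠ 0 := fun h0 => hzx (b₁.eq_of_length_eq_zero h0).symm
        omega
      refine rec s z t (a.append b₁) b₂ sr' tr' r' hs ht hpath' (fun y hy => hA y ?_) hsr' htr'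
        hr' hr'A hz' ?_ hlen
      · rw [← Walk.append_assoc, ← hb12] at hy; exact hy
      · intro y hy hyR'
        rw [Walk.mem_support_append_iff] at hy
        rcases hy with hy | hy
        · exact absurd hyR' (haR' y hy)
        · exact hzfirst y hy hyR'
    · -- `b` misses `r'` too: `a ++ b` and `r'` are disjoint
      refine ⟨s, t, sr', tr', a.append b, r', hs, ht, hsr', htr', hpath, hr', hA, hr'A,
        fun y hy hyR' => ?_⟩
      rw [Walk.mem_support_append_iff] at hy
      rcases hy with hy | hy
      · exact haR' y hy hyR'
      · exact hmeet ⟨y, hy, hyR'⟩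
  by_cases hqL : ∃ y ∈ q.support, y ∈ L
  · -- `y` = last vertex of `q` in `L`, `q = q₁ ++ q₂`, `q₂ ∩ L = {y}`
    obtain ⟨y, q₁, q₂, hq12, hyL, hylast⟩ := exists_append_last_mem L q hqL
    have hqpath : (q₁.append q₂).IsPath := by rw [← hq12]; exact hq
    obtain ⟨-, hq₂, -⟩ := isPath_append_iff'.1 hqpath
    have hq₂q : ∀ w ∈ q₂.support, w ∈ q.support := fun w hw => by
      rw [hq12, Walk.mem_support_append_iff]; exact Or.inr hw
    have hq₂A : ∀ w ∈ q₂.support, w ∈ A := fun w hw => hqA w (hq₂q w hw)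
    have hxq₂ : x ∉ q₂.support := fun h => hxq (hq₂q x h)
    have hq₂L : ∀ w ∈ q₂.support, w ≠ y → w ∉ L := fun w hw hwy hwL => hwy (hylast w hw hwL)
    have hyL' := hyL
    rw [hL] at hyL'
    obtain ⟨hyor, hyx⟩ := hyL'
    -- is `y` in `P⁻` or in `R⁻`?
    by_cases hya : y ∈ a.support
    · -- CASE `y ∈ P⁻`: switch the reference path
      -- split `a` at `y`: `a = a₁ ++ a₂`
      obtain ⟨a₁, a₂, ha12⟩ := Walk.mem_support_iff_exists_append.1 hya
      have hapath : (a₁.append a₂).IsPath := by rw [← ha12]; exact ha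
      obtain ⟨ha₁, -, ha₁₂⟩ := isPath_append_iff'.1 hapath
      have ha₁a : ∀ w ∈ a₁.support, w ∈ a.support := fun w hw => by
        rw [ha12, Walk.mem_support_append_iff]; exact Or.inl hw
      -- the new second path `r' = a₁ ++ q₂`
      have hxa₁ : x ∉ a₁.support := fun h => hyx (ha₁₂ x h a₂.end_mem_support).symm
      have ha₁L : ∀ w ∈ a₁.support, w ≠ y → w ∈ L := fun w hw hwy => by
        rw [hL]; exact ⟨Or.inl (ha₁a w hw), fun hwx => hxa₁ (hwx ▸ hw)⟩
      have hr'path : (a₁.append q₂).IsPath := by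
        rw [isPath_append_iff']
        refine ⟨ha₁, hq₂, fun w hw hwq => ?_⟩
        by_contra hwy
        exact hq₂L w hwq hwy (ha₁L w hw hwy)
      have hr'A : ∀ w ∈ (a₁.append q₂).support, w ∈ A := by
        intro w hw
        rw [Walk.mem_support_append_iff] at hw
        rcases hw with hw | hw
        · exact hA w (by rw [Walk.mem_support_append_iff]; exact Or.inl (ha₁a w hw))
        · exact hq₂A w hw
      -- `c` = first vertex of `r₁` on `b` (it exists: `x`); `r₁ = c₁ ++ c₂`
      obtain ⟨c, c₁, c₂, hc12, hcb, hcfirst⟩ :=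
        exists_append_first_mem {w | w ∈ b.support} r₁
          ⟨x, r₁.end_mem_support, b.start_mem_support⟩
      have hcb' : c ∈ b.support := hcb
      have hc₁path : c₁.IsPath := by
        have : (c₁.append c₂).IsPath := by rw [← hc12]; exact hr₁
        exact (isPath_append_iff'.1 this).1
      -- split `b` at `c`: `b = b₃ ++ b₄`
      obtain ⟨b₃, b₄, hb34⟩ := Walk.mem_support_iff_exists_append.1 hcb'
      have hbpath : (b₃.append b₄).IsPath := by rw [← hb34]; exact hb
      obtain ⟨-, hb₄, -⟩ := isPath_append_iff'.1 hbpath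
      have hb₄b : ∀ w ∈ b₄.support, w ∈ b.support := fun w hw => by
        rw [hb34, Walk.mem_support_append_iff]; exact Or.inr hw
      -- vertices of `c₁` other than `c` lie in `R⁻` and off `b`
      have hc₁r₁ : ∀ w ∈ c₁.support, w ∈ r₁.support := fun w hw => by
        rw [hc12, Walk.mem_support_append_iff]; exact Or.inl hw
      have hc₁b : ∀ w ∈ c₁.support, w ≠ c → w ∉ b.support := fun w hw hwc hwb =>
        hwc (hcfirst w hw hwb)
      have hc₁x : ∀ w ∈ c₁.support, w ≠ c → w ≠ x := fun w hw hwc hwx =>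
        hc₁b w hw hwc (hwx ▸ b.start_mem_support)
      -- the new reference path `p' = c₁ ++ b₄`
      have hp'path : (c₁.append b₄).IsPath := by
        rw [isPath_append_iff']
        refine ⟨hc₁path, hb₄, fun w hw hwb₄ => ?_⟩
        by_contra hwc
        exact hc₁b w hw hwc (hb₄b w hwb₄)
      have hp'A : ∀ w ∈ (c₁.append b₄).support, w ∈ A := by
        intro w hw
        rw [Walk.mem_support_append_iff] at hw
        rcases hw with hw | hw
        · exact hr₁A w (hc₁r₁ w hw)
        · exact hA w (by rw [Walk.mem_support_append_iff]; exact Or.inr (hb₄b w hw))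
      -- `r'` misses `c₁ ∖ {c}`
      have hc₁R' : ∀ w ∈ c₁.support, w ≠ c → w ∉ (a₁.append q₂).support := by
        intro w hw hwc hwR'
        have hwx : w ≠ x := hc₁x w hw hwc
        have hwr₁ : w ∈ r₁.support := hc₁r₁ w hw
        rw [Walk.mem_support_append_iff] at hwR'
        rcases hwR' with hwa₁ | hwq₂
        · exact hr₁a w hwr₁ hwx (ha₁a w hwa₁)
        · -- `w ∈ q₂ ∩ R⁻ ⊆ q₂ ∩ L = {y}`, but `y ∈ P⁻` is off `r`
          have hwL : w ∈ L := by rw [hL]; exact ⟨Or.inr hwr₁, hwx⟩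
          have hwy : w = y := hylast w hwq₂ hwL
          refine hr₁a w hwr₁ hwx ?_
          rw [hwy]; exact hya
      -- does `b₄` meet `r'`?
      by_cases hmeet : ∃ w ∈ b₄.support, w ∈ {w | w ∈ (a₁.append q₂).support}
      · obtain ⟨z, b₅, b₆, hb56, hz, hzfirst⟩ :=
          exists_append_first_mem {w | w ∈ (a₁.append q₂).support} b₄ hmeet
        have hz' : z ∈ (a₁.append q₂).support := hz
        have hpath'' : ((c₁.append b₅).append b₆).IsPath := by
          rw [← Walk.append_assoc, ← hb56]; exact hp'path
        -- the tail shortens: `b₆ ≤ b₄ ≤ b`, strictly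
        have hlen : b₆.length < b.length := by
          have h1 : b.length = b₃.length + b₄.length := by rw [hb34, Walk.length_append]
          have h2 : b₄.length = b₅.length + b₆.length := by rw [hb56, Walk.length_append]
          by_cases hcx : c = x
          · -- `z ∈ r'` but `x ∉ r'`, so `b₅` is not trivial
            have hzx : z ≠ x := by
              intro hzx
              have hz'' := hz'
              rw [hzx, Walk.mem_support_append_iff] at hz''
              rcases hz'' with h | h
              · exact hxa₁ h
              · exact hxq₂ h
            have : b₅.length ≠ 0 := fun h0 =>
              hzx ((b₅.eq_of_length_eq_zero h0).symm.trans hcx)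
            omega
          · have : b₃.length ≠ 0 := fun h0 => hcx (b₃.eq_of_length_eq_zero h0).symm
            omega
        refine rec sr z t (c₁.append b₅) b₆ s tq (a₁.append q₂) hsr ht hpath''
          (fun w hw => hp'A w ?_) hs htq hr'path hr'A hz' ?_ hlen
        · rw [← Walk.append_assoc, ← hb56] at hw; exact hw
        · intro w hw hwR'
          rw [Walk.mem_support_append_iff] at hw
          rcases hw with hw | hw
          · by_cases hwc : w = c
            · have hcz : c = z := hzfirst c b₅.start_mem_support (hwc ▸ hwR')
              rw [hwc, hcz]
            · exact absurd hwR' (hc₁R' w hw hwc)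
          · exact hzfirst w hw hwR'
      · -- `p' = c₁ ++ b₄` and `r'` are disjoint
        refine ⟨sr, t, s, tq, c₁.append b₄, a₁.append q₂, hsr, ht, hs, htq, hp'path, hr'path,
          hp'A, hr'A, fun w hw hwR' => ?_⟩
        rw [Walk.mem_support_append_iff] at hw
        rcases hw with hw | hw
        · by_cases hwc : w = c
          · exact hmeet ⟨w, hwc ▸ b₄.start_mem_support, hwR'⟩
          · exact hc₁R' w hw hwc hwR'
        · exact hmeet ⟨w, hw, hwR'⟩
    · -- CASE `y ∈ R⁻`: the new second path `r' = r₁[→ y] ++ q₂`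
      have hyr₁ : y ∈ r₁.support := hyor.resolve_left hya
      obtain ⟨d₁, d₂, hd12⟩ := Walk.mem_support_iff_exists_append.1 hyr₁
      have hdpath : (d₁.append d₂).IsPath := by rw [← hd12]; exact hr₁
      obtain ⟨hd₁, -, hd₁₂⟩ := isPath_append_iff'.1 hdpath
      have hd₁r₁ : ∀ w ∈ d₁.support, w ∈ r₁.support := fun w hw => by
        rw [hd12, Walk.mem_support_append_iff]; exact Or.inl hw
      have hxd₁ : x ∉ d₁.support := fun h => hyx (hd₁₂ x h d₂.end_mem_support).symm
      have hd₁L : ∀ w ∈ d₁.support, w ≠ y → w ∈ L := fun w hw hwy => by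
        rw [hL]; exact ⟨Or.inr (hd₁r₁ w hw), fun hwx => hxd₁ (hwx ▸ hw)⟩
      have hr'path : (d₁.append q₂).IsPath := by
        rw [isPath_append_iff']
        refine ⟨hd₁, hq₂, fun w hw hwq => ?_⟩
        by_contra hwy
        exact hq₂L w hwq hwy (hd₁L w hw hwy)
      have hr'A : ∀ w ∈ (d₁.append q₂).support, w ∈ A := by
        intro w hw
        rw [Walk.mem_support_append_iff] at hw
        rcases hw with hw | hw
        · exact hr₁A w (hd₁r₁ w hw)
        · exact hq₂A w hw
      refine finish sr tq (d₁.append q₂) hsr htq hr'path hr'A fun w hwa hwR' => ?_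
      rw [Walk.mem_support_append_iff] at hwR'
      rcases hwR' with hw | hw
      · -- `w ∈ a ∩ d₁ ⊆ a ∩ R⁻ = ∅` (and `x ∉ d₁`)
        have hwx : w ≠ x := fun hwx => hxd₁ (hwx ▸ hw)
        exact hr₁a w (hd₁r₁ w hw) hwx hwa
      · -- `w ∈ a ∩ q₂`: `x ∉ q₂`, and `a ∖ {x} ⊆ L` meets `q₂` only at `y ∉ a`
        have hwx : w ≠ x := fun hwx => hxq₂ (hwx ▸ hw)
        have hwL : w ∈ L := by rw [hL]; exact ⟨Or.inl hwa, hwx⟩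
        have hwy : w = y := hylast w hw hwL
        apply hya
        rw [← hwy]; exact hwa
  · -- `q` misses `L`, hence `a` (`a ⊆ L ∪ {x}`, `x ∉ q`)
    refine finish sq tq q hsq htq hq hqA fun w hwa hwQ => ?_
    by_cases hwx : w = x
    · exact hxq (hwx ▸ hwQ)
    · exact hqL ⟨w, hwQ, by rw [hL]; exact ⟨Or.inl hwa, hwx⟩⟩

/-- **The induction behind Menger's theorem for two paths**: the configuration of
`exists_two_disjoint_paths_step` with a tail of length `≤ n` can be improved to two
vertex-disjoint admissible `S`–`T` paths. [cite: Diestel2017, Thm. 3.3.1] -/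
theorem exists_two_disjoint_paths_aux
    (hcut : ∀ z ∈ A, ∃ (s t : V) (q : G.Walk s t), s ∈ S ∧ t ∈ T ∧
      (∀ y ∈ q.support, y ∈ A) ∧ z ∉ q.support) (n : ℕ) :
    ∀ (s x t : V) (a : G.Walk s x) (b : G.Walk x t) (sr tr : V) (r : G.Walk sr tr),
      s ∈ S → t ∈ T → (a.append b).IsPath → (∀ y ∈ (a.append b).support, y ∈ A) →
      sr ∈ S → tr ∈ T → r.IsPath → (∀ y ∈ r.support, y ∈ A) → x ∈ r.support →
      (∀ y ∈ a.support, y ∈ r.support → y = x) → b.length ≤ n →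
      ∃ (s₁ t₁ s₂ t₂ : V) (p₁ : G.Walk s₁ t₁) (p₂ : G.Walk s₂ t₂),
        s₁ ∈ S ∧ t₁ ∈ T ∧ s₂ ∈ S ∧ t₂ ∈ T ∧ p₁.IsPath ∧ p₂.IsPath ∧
        (∀ y ∈ p₁.support, y ∈ A) ∧ (∀ y ∈ p₂.support, y ∈ A) ∧
        ∀ y ∈ p₁.support, y ∉ p₂.support := by
  induction n with
  | zero =>
    intro s x t a b sr tr r hs ht hpath hA hsr htr hr hrA hxr hfirst hb
    exact exists_two_disjoint_paths_step hcut s x t a b sr tr r hs ht hpath hA hsr htr hr hrA hxr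
      hfirst fun _ _ _ _ b' _ _ _ _ _ _ _ _ _ _ _ _ _ hlt =>
        absurd (Nat.lt_of_lt_of_le hlt hb) (Nat.not_lt_zero _)
  | succ n ih =>
    intro s x t a b sr tr r hs ht hpath hA hsr htr hr hrA hxr hfirst hb
    exact exists_two_disjoint_paths_step hcut s x t a b sr tr r hs ht hpath hA hsr htr hr hrA hxr
      hfirst fun s' x' t' a' b' sr' tr' r' hs' ht' hpath' hA' hsr' htr' hr' hrA' hxr' hfirst' hlt =>
        ih s' x' t' a' b' sr' tr' r' hs' ht' hpath' hA' hsr' htr' hr' hrA' hxr' hfirst'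
          (Nat.le_of_lt_succ (Nat.lt_of_lt_of_le hlt hb))

/-- **Menger's theorem for two paths between vertex sets** (Menger 1927; Diestel, Thm. 3.3.1,
`k = 2`): if some `S`–`T` walk has all its vertices in `A`, and every vertex of `A` is avoided
by some such walk, then there are two `S`–`T` paths with all vertices in `A` and disjoint vertex
sets. [cite: Diestel2017, Thm. 3.3.1] -/
theorem exists_two_disjoint_paths {A S T : Set V}
    (hone : ∃ (s t : V) (q : G.Walk s t), s ∈ S ∧ t ∈ T ∧ ∀ y ∈ q.support, y ∈ A)
    (hcut : ∀ z ∈ A, ∃ (s t : V) (q : G.Walk s t), s ∈ S ∧ t ∈ T ∧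
      (∀ y ∈ q.support, y ∈ A) ∧ z ∉ q.support) :
    ∃ (s₁ t₁ s₂ t₂ : V) (p₁ : G.Walk s₁ t₁) (p₂ : G.Walk s₂ t₂),
      s₁ ∈ S ∧ t₁ ∈ T ∧ s₂ ∈ S ∧ t₂ ∈ T ∧ p₁.IsPath ∧ p₂.IsPath ∧
      (∀ y ∈ p₁.support, y ∈ A) ∧ (∀ y ∈ p₂.support, y ∈ A) ∧
      ∀ y ∈ p₁.support, y ∉ p₂.support := by
  classical
  obtain ⟨s, t, q, hs, ht, hqA⟩ := hone
  have hp : q.bypass.IsPath := q.bypass_isPath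
  have hpA : ∀ y ∈ q.bypass.support, y ∈ A := fun y hy =>
    hqA y (q.support_bypass_subset_support hy)
  -- start from the pair `(p, p)`, which meets first at the start of `p`
  exact exists_two_disjoint_paths_aux (G := G) (A := A) (S := S) (T := T) hcut
    q.bypass.length s s t Walk.nil q.bypass s t q.bypass hs ht (by simpa using hp)
    (by simpa using hpA) hs ht hp hpA q.bypass.start_mem_support
    (fun y hy _ => by simpa using hy) le_rfl

/-- **A one-vertex cut** (contrapositive of `exists_two_disjoint_paths`; the form used for the
pivotal sites of the two-arm event, Nolin 2008, §6.2, proof of Thm. 27, Case 3): if some `S`–`T`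
walk has all its vertices in `A` but no two `S`–`T` paths with vertices in `A` have disjoint
vertex sets, then some vertex of `A` lies on every `S`–`T` walk with vertices in `A`. [cite: Diestel2017, Thm. 3.3.1] [cite: Nolin2008, §6.2, proof of Thm. 27, Case 3 (arXiv 0711.4948: Thm. 26)] -/
theorem exists_mem_support_forall {A S T : Set V}
    (hone : ∃ (s t : V) (q : G.Walk s t), s ∈ S ∧ t ∈ T ∧ ∀ y ∈ q.support, y ∈ A)
    (htwo : ¬ ∃ (s₁ t₁ s₂ t₂ : V) (p₁ : G.Walk s₁ t₁) (p₂ : G.Walk s₂ t₂),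
      s₁ ∈ S ∧ t₁ ∈ T ∧ s₂ ∈ S ∧ t₂ ∈ T ∧ p₁.IsPath ∧ p₂.IsPath ∧
      (∀ y ∈ p₁.support, y ∈ A) ∧ (∀ y ∈ p₂.support, y ∈ A) ∧
      ∀ y ∈ p₁.support, y ∉ p₂.support) :
    ∃ z ∈ A, ∀ (s t : V) (q : G.Walk s t), s ∈ S → t ∈ T → (∀ y ∈ q.support, y ∈ A) →
      z ∈ q.support := by
  by_contra h
  push Not at h
  exact htwo (exists_two_disjoint_paths hone fun z hz => by
    obtain ⟨s, t, q, hs, ht, hqA, hzq⟩ := h z hz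
    exact ⟨s, t, q, hs, ht, hqA, hzq⟩)

end Menger

end Literature.Combinatorics.SimpleGraph
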